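import Mathlib
import HarnessLib
import Summits.HubbardSuperconductivity.HubbardSuperconductivity.Theorems.KLProgrammeH10TwoPointLimitSymbolFrameInstance
import Summits.HubbardSuperconductivity.HubbardSuperconductivity.Theorems.KLProgrammeKLRegimeSplitEvalDerivBounds
import Summits.HubbardSuperconductivity.HubbardSuperconductivity.Theorems.KLProgrammeKLRegimeSplitFrameLemmas

/-!
# Route `KLProgramme` — VL child `KLRegimeVolumeLimitV17F2` (stmt-HubbardSuperconductivity-20440), closer MODEL file M2 «MISMATCH-SLICE», bracket (c),
# part 2e-0: the MODEL data consumed by the sampled symbol-difference bounds of `…SymbolIncrementSampled` for the BGM multipliers on two frames —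
# global `C²` bounds of p4's angular factor (compactness), the SIGNED zone inequality of a frame band, the sup of a frame band, and the band
# INCREMENT `e_{K′} − e_K = δ_{K′ ⊖ K}` on `Fin 2 → ℝ` with its `C²` sizes from the coefficient weights of `K′ ⊖ K`

Cell `gate-hubbard-kl`, seat hubbard-kl-k3c4-p2 (g11; UV / Matsubara all-U lane), ask «MISMATCH-SLICE» (= M2, bracket (c)) of the VL registrant
k3c4-p1 g11.  `…SymbolIncrementSampled.norm_fwdDiff_two_space/time_symbolDiff_le` read: global sup bounds `z₀, z₁, z₂` of the (frame-free) angular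
factor `Z` and its first two Fréchet derivatives; the common band data `E₀, K₁, K₂` of the two frames (`K₁ = 4 + 2A`, `K₂ = 4 + 4A` are p4's
`norm_fderiv_frameBand_le` / `norm_iteratedFDeriv_two_frameBand_le`); the increment data `P₀, P₁, P₂` ON `Fin 2 → ℝ`; and the zone hypothesis
«both bands exceed `Λ` near the seam» with the SIGN.  Here:

* §1 **`exists_angularFactor_derivBounds`** — p4's angular factor (`…SymbolAngularFactor`, hypothesis `hZ`, `z > 0`) is smooth with compact support
  (`angularFactor_zone`), hence `∃ z₁ z₂, ∀ p, ‖DZ(p)‖ ≤ z₁ ∧ ‖D²Z(p)‖ ≤ z₂` (with `z₀ = 1`, `abs_angularFactor_le_one`); the constants depend on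
  `(n₁, n₂, ω₁, ω₂, z)` only — L-, M- and frame-free;
* §2 **`frameBand_zone_pos`** — the signed form of p4's `frameBand_zone`: `π − z ≤ |p_j| ≤ π + z ⇒ Λ < e_K(toLp p)`; `abs_sqDispersion_le_four`,
  **`abs_frameBand_le`** (`|e_K(toLp p)| ≤ 4 + A + |μ|`);
* §3 **`frameBand_sub_eq_frameShift_fsub`** (`e_{K′}(toLp k) − e_K(toLp k) = δ_{K′ ⊖ K}(toLp k)`), `norm_iteratedFDeriv_frameShift_le_coeffNorm`,
  **`frameIncrement_toLp_data`** — if `coeffNorm j (K′ ⊖ K) ≤ ε` for `j ≤ 2` then the increment on `Fin 2 → ℝ` has `|·| ≤ ε`, `‖D·‖ ≤ 2ε`, `‖D²·‖ ≤ 4ε`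
  (p4's `norm_iteratedFDeriv_frameShift_toLp_le` at the frame `K′ ⊖ K`); on the two volumes' top flow frames `ε = max_j c_j(n⋆)/L`.

Everything is proved; no definitions, no named facts; nothing about the model is asserted. [folklore]
-/

noncomputable section

namespace Summit.HubbardSuperconductivity.HubbardSuperconductivity.Theorems.TorusFourierL2

set_option linter.dupNamespace false -- summit = problem name (single-conjunct summit), D-0017

open Set Literature.MathematicalPhysics.QuantumLattice Literature.MathematicalPhysics.QuantumLattice.BandSectorCounting Literature.Analysis.SpecialFunctions
open Summit.HubbardSuperconductivity.HubbardSuperconductivity.Theorems.DispersionFlow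
open Summit.HubbardSuperconductivity.HubbardSuperconductivity.Theorems.KLRegimeSplit
open Summit.HubbardSuperconductivity.HubbardSuperconductivity.Theorems.PerturbedFermiCurve
open scoped Real

/-! ## §1 Global `C²` bounds of the angular factor, by compactness -/

section Angular

variable {z : ℝ} {n₁ n₂ : ℕ} {ω₁ ω₂ : ℤ} {Z : (Fin 2 → ℝ) → ℝ}
  (hZ : ∀ p, Z p = gnCutoff ((π + z) ^ 2 / π ^ 2) ((π + z) ^ 2) (p 0 ^ 2) * gnCutoff ((π + z) ^ 2 / π ^ 2) ((π + z) ^ 2) (p 1 ^ 2) *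
    ((radialCutoffC (1 / 2) (momToComplex p) * sectorWeightCirc n₁ ω₁ (polarAngle p)) *
      (radialCutoffC (1 / 2) (momToComplex p) * sectorWeightCirc n₂ ω₂ (polarAngle p))))
include hZ

/-- **The angular factor has compact support** (it vanishes outside the sup-norm ball of radius `π + z`). [folklore] -/
theorem hasCompactSupport_angularFactor (hz : 0 < z) : HasCompactSupport Z := by
  refine HasCompactSupport.intro (isCompact_closedBall (0 : Fin 2 → ℝ) (π + z)) fun p hp => ?_
  rw [Metric.mem_closedBall, dist_zero_right, not_le] at hp
  -- some coordinate exceeds `π + z`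
  have hex : ∃ j, π + z ≤ |p j| := by
    by_contra h
    push Not at h
    have hle : ‖p‖ ≤ π + z := by
      refine (pi_norm_le_iff_of_nonneg (by linarith [Real.pi_pos])).2 fun j => ?_
      rw [Real.norm_eq_abs]; exact (h j).le
    linarith
  exact angularFactor_zone hZ hz hex

/-- **Global `C²` bounds of the angular factor**: `∃ z₁ z₂ ≥ 0` with `‖DZ(p)‖ ≤ z₁`, `‖D²Z(p)‖ ≤ z₂` for all `p` (continuity + compact support;
the constants depend on `(n₁, n₂, ω₁, ω₂, z)` only). [folklore] -/
theorem exists_angularFactor_derivBounds (hz : 0 < z) :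
    ∃ z₁ z₂ : ℝ, 0 ≤ z₁ ∧ 0 ≤ z₂ ∧ (∀ p, ‖fderiv ℝ Z p‖ ≤ z₁) ∧ (∀ p, ‖iteratedFDeriv ℝ 2 Z p‖ ≤ z₂) := by
  have hC : ContDiff ℝ 2 Z := contDiff_angularFactor hZ
  have hcs : HasCompactSupport Z := hasCompactSupport_angularFactor hZ hz
  obtain ⟨C₁, hC₁⟩ := (hC.continuous_fderiv (by norm_num)).bounded_above_of_compact_support (hcs.fderiv (𝕜 := ℝ))
  obtain ⟨C₂, hC₂⟩ := (hC.continuous_iteratedFDeriv (m := 2) le_rfl).bounded_above_of_compact_support (hcs.iteratedFDeriv 2)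
  refine ⟨max C₁ 0, max C₂ 0, le_max_right _ _, le_max_right _ _, fun p => (hC₁ p).trans (le_max_left _ _),
    fun p => (hC₂ p).trans (le_max_left _ _)⟩

end Angular

/-! ## §2 The frame band on `Fin 2 → ℝ`: signed zone inequality and sup -/

/-- `|ε₀(k)| ≤ 4` for the square-lattice dispersion `ε₀ = −2(cos k₀ + cos k₁)`. [folklore] -/
theorem abs_sqDispersion_le_four (k : Fin 2 → ℝ) : |sqDispersion k| ≤ 4 := by
  rw [sqDispersion, abs_le]
  have h0 := Real.abs_cos_le_one (k 0)
  have h1 := Real.abs_cos_le_one (k 1)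
  rw [abs_le] at h0 h1
  constructor <;> nlinarith

/-- **Sup of a frame band on `Fin 2 → ℝ`**: `|e_K(toLp p)| ≤ 4 + A + |μ|` for a frame of `C²` size `A`. [folklore] -/
theorem abs_frameBand_le {K : TrigPolyC4v} {A : ℝ} (hA : ∀ p : Momentum, ∀ j ≤ 2, ‖iteratedFDeriv ℝ j (frameShift K) p‖ ≤ A) (μ : ℝ)
    (p : Fin 2 → ℝ) : |frameLevel μ K (WithLp.toLp 2 p)| ≤ 4 + A + |μ| := by
  rw [frameLevel_toLp]
  have h1 := abs_sqDispersion_le_four p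
  have h2 := abs_frameShift_toLp_le hA p
  calc |sqDispersion p + frameShift K (WithLp.toLp 2 p) - μ| ≤ |sqDispersion p + frameShift K (WithLp.toLp 2 p)| + |μ| := abs_sub _ _
    _ ≤ |sqDispersion p| + |frameShift K (WithLp.toLp 2 p)| + |μ| := by gcongr; exact abs_add_le _ _
    _ ≤ 4 + A + |μ| := by gcongr

/-- **Signed zone inequality**: near the zone boundary (`π − z ≤ |p_j| ≤ π + z` for some `j`, `z ≤ 1`) the frame band EXCEEDS `Λ`
(positively) once `Λ + A + z² < −μ` — the sign form of p4's `frameBand_zone`, needed for the interpolated bands of the increment bound.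
[folklore] -/
theorem frameBand_zone_pos {K : TrigPolyC4v} {A : ℝ} (hA : ∀ p : Momentum, ∀ j ≤ 2, ‖iteratedFDeriv ℝ j (frameShift K) p‖ ≤ A)
    {μ Λ z : ℝ} (hz1 : z ≤ 1) (hgap : Λ + A + z ^ 2 < -μ) {p : Fin 2 → ℝ} {j : Fin 2} (h1 : π - z ≤ |p j|) (h2 : |p j| ≤ π + z) :
    Λ < frameLevel μ K (WithLp.toLp 2 p) := by
  have hzπ : z ≤ π := hz1.trans (by linarith [Real.pi_gt_three])
  have hcos : Real.cos (p j) ≤ -Real.cos z := cos_le_neg_cos_of_near_pi hzπ h1 h2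
  have hcz : 1 - z ^ 2 / 2 ≤ Real.cos z := Real.one_sub_sq_div_two_le_cos
  have hε : -z ^ 2 ≤ sqDispersion p := by
    rw [sqDispersion]
    have hother : ∀ i, Real.cos (p i) ≤ 1 := fun i => Real.cos_le_one _
    fin_cases j
    · have := hother 1; simp only [Fin.zero_eta, Fin.isValue] at hcos; nlinarith
    · have := hother 0; simp only [Fin.mk_one, Fin.isValue] at hcos; nlinarith
  have hδ := abs_le.1 (abs_frameShift_toLp_le hA p)
  rw [frameLevel_toLp]
  linarith

/-! ## §3 The band increment of two frames on `Fin 2 → ℝ` -/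

/-- **`e_{K′}(toLp k) − e_K(toLp k) = δ_{K′ ⊖ K}(toLp k)`** (`δ_X = frameShift X = −X.eval`). [folklore] -/
theorem frameBand_sub_eq_frameShift_fsub (μ : ℝ) (K K' : TrigPolyC4v) :
    (fun k : Fin 2 → ℝ => frameLevel μ K' (WithLp.toLp 2 k) - frameLevel μ K (WithLp.toLp 2 k)) =
      fun k : Fin 2 → ℝ => frameShift (fsub K' K) (WithLp.toLp 2 k) := by
  funext k
  rw [frameLevel_toLp, frameLevel_toLp, frameShift_toLp, frameShift_toLp, frameShift_toLp, eval_fsub]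
  ring

/-- **The `C^j` sizes of `δ_X` on `Momentum` from the coefficient weights**: `‖Dʲ(frameShift X)(q)‖ ≤ coeffNorm j X`
(`norm_iteratedFDeriv_evalM_le_coeffNorm`; `frameShift X = −evalM X`). [folklore] -/
theorem norm_iteratedFDeriv_frameShift_le_coeffNorm (X : TrigPolyC4v) (j : ℕ) (q : Momentum) :
    ‖iteratedFDeriv ℝ j (frameShift X) q‖ ≤ X.coeffNorm j := by
  have hfun : frameShift X = -(evalM X) := by funext q; simp [frameShift, evalM]
  rw [hfun, iteratedFDeriv_neg_apply, norm_neg]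
  exact norm_iteratedFDeriv_evalM_le_coeffNorm X j q

/-- **THE BAND INCREMENT ON `Fin 2 → ℝ` AND ITS `C²` SIZES**: if `coeffNorm j (K′ ⊖ K) ≤ ε` for `j = 0, 1, 2`, then with
`v(k) = e_{K′}(toLp k) − e_K(toLp k)`: `|v| ≤ ε`, `‖Dv‖ ≤ 2ε`, `‖D²v‖ ≤ 4ε` — the `P₀, P₁, P₂` of `norm_fwdDiff_two_space_symbolDiff_le`.  On the two
volumes' top flow frames `ε = max_{j ≤ 2} c_j(n⋆)/L` (`TwoPointAssembly.coeffNorm_fsub_klFlowFrameU_le_of_towerV17F2`). [folklore] -/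
theorem frameIncrement_toLp_data (μ : ℝ) (K K' : TrigPolyC4v) {ε : ℝ} (h : ∀ j ≤ 2, (fsub K' K).coeffNorm j ≤ ε) :
    (∀ k : Fin 2 → ℝ, |frameLevel μ K' (WithLp.toLp 2 k) - frameLevel μ K (WithLp.toLp 2 k)| ≤ ε) ∧
    (∀ k : Fin 2 → ℝ, ‖fderiv ℝ (fun k : Fin 2 → ℝ => frameLevel μ K' (WithLp.toLp 2 k) - frameLevel μ K (WithLp.toLp 2 k)) k‖ ≤ 2 * ε) ∧
    (∀ k : Fin 2 → ℝ, ‖iteratedFDeriv ℝ 2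
      (fun k : Fin 2 → ℝ => frameLevel μ K' (WithLp.toLp 2 k) - frameLevel μ K (WithLp.toLp 2 k)) k‖ ≤ 4 * ε) := by
  have hA : ∀ p : Momentum, ∀ j ≤ 2, ‖iteratedFDeriv ℝ j (frameShift (fsub K' K)) p‖ ≤ ε := fun p j hj =>
    (norm_iteratedFDeriv_frameShift_le_coeffNorm _ j p).trans (h j hj)
  have hF := frameBand_sub_eq_frameShift_fsub μ K K'
  refine ⟨fun k => ?_, fun k => ?_, fun k => ?_⟩
  · have e := congrFun hF k
    rw [e]; exact abs_frameShift_toLp_le hA k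
  · rw [hF]; exact norm_fderiv_frameShift_toLp_le hA k
  · rw [hF]
    have h2 := norm_iteratedFDeriv_frameShift_toLp_le hA k (j := 2) le_rfl
    linarith

end Summit.HubbardSuperconductivity.HubbardSuperconductivity.Theorems.TorusFourierL2

end
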